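import Literature.NumberTheory.EllipticCurves.Rank1Residual.X11RankOneCertificates.Schema
import Literature.NumberTheory.QuadraticFields.BinaryQuadraticFormsClassNumber
import HarnessLib

/-!
# Class X6 ∧ analytic rank `0` (good supersingular prime of a semistable curve) — the per-pair
# certificate record schema of the PRINT tier and its in-kernel recheck

Cell `bsd-print-x6` (D-0131 (2) print tier, key `x6`; HOME `run/shared/lean/pub/bsd-print-x6/`), typer seat ty3
(certificate-record schema + per-class display files). PARTITION (D-0054): leaf X6 ∧ r = 0 (K3 row A6) —
types-the-object-of (the per-pair certificate data); closes NONE. HONEST FRAMING: nothing in this file is a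
statement about an elliptic curve and nothing is a named fact; BSD is not advanced by a schema. It fixes the
FORMAT in which the finite certificate data of one pair `(E, p)` of the leaf **`ClassX6 W p ∧ W.analyticRank = 0`**
(`Rank1Residual.ClassX6 W p := GoodSS W p ∧ Semistable W ∧ (5 ≤ p ∨ a₃ = 0)`, `Rank1Residual/Predicates.lean`)
enter the tree as DATA, one record per (Cremona isogeny class, prime), in the sibling files
`RankZeroCertificateRecords*.lean` (each states `certified [r₁, …] = true`, proved by `decide +kernel`: the kernel
re-runs `Record.check` on the literal data) — as `Literature/…/Rank1Residual/X11RankOneCertificates/Schema.lean`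
does for X11 ∧ r = 1, whose naive kernel-evaluable arithmetic (`natVal`, `isPrimeBelow504100`, `invariants`,
`c4Of`, `c6Of`, `discOf`, `countPoints`) is REUSED here. The sibling `RankZeroCertificateClaim.lean` DERIVES
`ClassX6` and the BSTW-scope witness `BSTWScope.HasWitness` from a passing recheck (kernel theorems) and says what
a record CLAIMS (analytic rank `0`, `#Ш_an`, `#tor`, `∏c` — the two-engine computation, a hypothesis) and how the
claim plus named inputs give Miller's `BSD(E,p)` on each road of the cell. Census displayed by the records files:
the sweep S-b residue of the class (bsdN sweep v4f `RESIDUE.jsonl`, entries `[p, "X6"]`: 734 pairs, `N < 5·10⁵`,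
all `r_an = 0`, all `p ∣ #Ш_an`; `p = 3`: 621, `5`: 86, `7`: 20, `11`: 4, `13`: 3).

## What a record records, and what the kernel rechecks (`Record.check`, decidable)

For the curve `label` (Cremona; reduced global minimal model `ainvs = [a₁,a₂,a₃,a₄,a₆]`) and the prime `p`:
* `bad = [(q, v_q(Δ)), …]` for every bad prime `q`. RECHECKED: each `q` prime (trial division), increasing,
  `conductor = ∏ q`, `|Δ(ainvs)| = ∏ q^{v_q(Δ)}` with `Δ` RECOMPUTED and each exponent exact (`q^v ∣ Δ`,
  `q^{v+1} ∤ Δ`), `q ∤ c₄` at every bad `q` and `gcd(Δ, c₄) = 1` — multiplicative reduction at every bad prime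
  (Silverman VII.5.1(b)) and global minimality by Silverman's criterion VII.1.1 (`ord_q c₄ = 0` wherever `q ∣ Δ`);
* `p`, `pointCount = #Ẽ(𝔽_p)`. RECHECKED: `p` an odd prime, `p = 3 ∨ 5 ≤ p`, `p ∤ Δ`, `countPoints = p + 1`
  (`a_p = 0`: supersingular, and the clause `a₃ = 0` at `p = 3`) — the decidable inputs of the tree's
  `Supersingular.classX6_of_intModel` / `SecondDescent.classX6_three_of_intModel`;
* `tamagawa = [(q, c_q), …]`, `tamagawaProduct`. RECHECKED against Tate's algorithm at a multiplicative prime of a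
  minimal model (type `I_n`, `n = v_q(Δ)`): `c_q = n` if split, else `2`/`1` for `n` even/odd; split ⟺
  `(−c₆ | q) = +1` for odd `q` (Euler's criterion by binary exponentiation `powModBin`), ⟺ `a₂ + a₃` even for
  `q = 2` (node-tangent quadratic `T² + T + (a₂ + a₃)` over `𝔽₂`, `a₁` odd);
* `torsion`, `rank = 0`, `rootNumber = +1`, `lRatioNum / lRatioDen = L(E,1)/Ω_E` (exact; `Ω_E` = Néron period ×
  number of real components = Cremona's `Ω`), `shaAn`. RECHECKED: positivity, `p ∤ torsion`, the rank-`0`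
  bookkeeping `shaAn · ∏ c_q · lRatioDen = lRatioNum · torsion²`, `shaAn` a square, `ordpSha = v_p(shaAn)`,
  `ordpTam = v_p(∏ c_q)`;
* `ram`: the (ram) primes (bad `q ≠ p`, `p ∤ v_q(Δ)`: `ρ̄_{E,p}` ramified at `q`). RECHECKED;
* `auxInert = q₀`, `auxDisc = D`, `auxClassNumber = h(−D)`: the auxiliary datum of the printed proof of
  Burungale–Skinner–Tian–Wan arXiv:2409.01350 Thm. 1.3 (§10.3: a (ram) prime `q₀`, `L = ℚ(√−D)` with `p`
  split, `q₀` inert, the other bad primes split, `(d_L, 2N) = 1`, `2` split if `2 ∤ N`; the cell-verified scope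
  `BSTWScope.HasWitness` of `Supersingular/KobayashiMainConjectureX6BSTWScope.lean` adds `p ∤ h_L`).
  RECHECKED (`D = 0` = none): `D ≡ 3 (4)` square-free, prime to `N`, `q₀ ∈ ram`, the Kronecker symbols,
  `h(−D) = Quadratic.BinQF.classNumber (−D)` (Cox Thm. 2.13; `= h_L` by `binQF_classNumber_eq` +
  `card_reducedForms_eq_classNumber`), `p ∤ h(−D)` — the inputs of `BSTWScope.hasWitness_of_kronecker`;
* `isogDegrees`, `galrep`, `ext` (road-specific claimed integers), `engines` (engine T = Cremona's tables,
  engine P = PARI/GP via cypari2 on the kit farm, job ids): documentation, not rechecked.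

NOT checked here (CLAIMS, `RankZeroCertificateClaim.lean`): analytic rank, `L(E,1)/Ω_E`, `#Ш_an`, `#tor`,
`c_q` as invariants of `E` (the recheck ties them to each other and to the model's decidable shadow).
Design: plain computable data and naive arithmetic, so `decide +kernel` runs the recheck in the kernel
(no `native_decide`, no extra axioms); `powModBin` comes with its correctness `powModBin_eq`.

References: Silverman *AEC* III.1, VII.1 Rem. 1.1, VII.5.1, C.15 [SilvermanAEC2009]; Ireland–Rosen Prop. 5.1.2
[IrelandRosen1990]; Cox Thm. 2.13, 7.7(ii) [Cox2013]; Skinner–Urban 2014 (ram) [SkinnerUrban2014];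
Burungale–Skinner–Tian–Wan arXiv:2409.01350v2 §10.3 (PRE; shape of the auxiliary datum only)
[BurungaleSkinnerTianWan2024]; Cremona's tables [Cremona2006]; Miller 2011 Def. 1.1 [Miller2011LMS].
-/

namespace Summit.BirchSwinnertonDyer.Rank1Residual.X6.PrintCert

open Literature.NumberTheory.EllipticCurves.Rank1Residual.X11RankOneCertificates
  (natVal isPrimeBelow504100 strictlyIncreasing invariants c4Of c6Of discOf countPoints)
open Literature.NumberTheory.QuadraticFields.Quadratic (BinQF)

/-! ### Naive arithmetic (kernel-evaluable): binary modular exponentiation and Euler's criterion -/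

/-- `b ^ e mod m` by binary exponentiation with `fuel` halvings of `e` (correct when `e < 2 ^ fuel`,
`powModBinAux_eq`). [folklore] -/
def powModBinAux : ℕ → ℕ → ℕ → ℕ → ℕ
  | 0, _, _, m => 1 % m
  | fuel + 1, b, e, m =>
    if e = 0 then 1 % m
    else
      let h := powModBinAux fuel (b * b % m) (e / 2) m
      if e % 2 = 1 then h * b % m else h

/-- `b ^ e mod m` for `e < 2⁶⁴` (`powModBin_eq`). [folklore] -/
def powModBin (b e m : ℕ) : ℕ := powModBinAux 64 (b % m) e m

/-- Correctness of the fuelled binary exponentiation. [folklore] -/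
theorem powModBinAux_eq (fuel b e m : ℕ) (he : e < 2 ^ fuel) : powModBinAux fuel b e m = b ^ e % m := by
  induction fuel generalizing b e with
  | zero =>
    have h0 : e = 0 := by simpa using he
    subst h0
    simp [powModBinAux]
  | succ fuel ih =>
    by_cases h0 : e = 0
    · subst h0; simp [powModBinAux]
    · have ih' := ih (b * b % m) (e / 2) (by omega)
      by_cases h1 : e % 2 = 1
      · have he' : 2 * (e / 2) + 1 = e := by omega
        simp only [powModBinAux, h0, h1, ↓reduceIte]
        rw [ih', ← Nat.pow_mod, ← pow_two, ← pow_mul, Nat.mul_mod, Nat.mod_mod, ← Nat.mul_mod, ← pow_succ, he']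
      · have he' : 2 * (e / 2) = e := by omega
        simp only [powModBinAux, h0, h1, ↓reduceIte]
        rw [ih', ← Nat.pow_mod, ← pow_two, ← pow_mul, he']

/-- `powModBin b e m = b ^ e % m` for `e < 2⁶⁴`. [folklore] -/
theorem powModBin_eq (b e m : ℕ) (he : e < 2 ^ 64) : powModBin b e m = b ^ e % m := by
  rw [powModBin, powModBinAux_eq _ _ _ _ he, ← Nat.pow_mod]

/-- Euler's criterion value `a^{(q−1)/2} mod q` of an integer `a` at an odd prime `q` (`1` = residue,
`q − 1` = non-residue, `0` = `q ∣ a`). [cite: IrelandRosen1990, Prop. 5.1.2 (Euler's criterion)] -/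
def eulerCrit (a : ℤ) (q : ℕ) : ℕ := powModBin (a % (q : ℤ)).toNat ((q - 1) / 2) q

/-- `(a | q) = +1` at an odd prime `q` (Bool, by Euler's criterion). [cite: IrelandRosen1990, Prop. 5.1.2] -/
def isQR (a : ℤ) (q : ℕ) : Bool := eulerCrit a q == 1
/-- `(a | q) = −1` at an odd prime `q` (Bool, by Euler's criterion). [cite: IrelandRosen1990, Prop. 5.1.2] -/
def isQNR (a : ℤ) (q : ℕ) : Bool := decide (2 < q) && (eulerCrit a q == q - 1)

/-- Integer square root by binary search with fuel (`128` halvings; exact for `n < 2¹²⁷`). [folklore] -/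
def isqrtAux : ℕ → ℕ → ℕ → ℕ → ℕ
  | 0, low, _, _ => low
  | fuel + 1, low, high, n =>
    if high ≤ low + 1 then (if high * high ≤ n then high else low)
    else
      let mid := (low + high) / 2
      if mid * mid ≤ n then isqrtAux fuel mid high n else isqrtAux fuel low mid n

/-- `⌊√n⌋` (see `isqrtAux`). [folklore] -/
def isqrt (n : ℕ) : ℕ := isqrtAux 128 0 n n

/-- `n` is a perfect square (Bool; a witness `isqrt n` is squared back, so `true` is always correct). [folklore] -/
def isSquareNat (n : ℕ) : Bool := isqrt n * isqrt n == n

/-- `isSquareNat` is sound: a root is exhibited. [folklore] -/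
theorem isSquare_of_isSquareNat {n : ℕ} (h : isSquareNat n = true) : IsSquare n :=
  ⟨isqrt n, by simpa [isSquareNat] using (beq_iff_eq.mp h).symm⟩

/-! ### Tate's algorithm at a multiplicative prime of a minimal model -/

/-- Split vs non-split multiplicative reduction of a MINIMAL integral model `[a₁,…,a₆]` at a prime `q`
with `q ∣ Δ`, `q ∤ c₄`: for odd `q`, split iff `−c₆` is a square mod `q` (the twist parameter `−c₄/c₆`
of the Tate curve is a square iff `−c₆` is, as `c₄ ≡ (c₆/c₄)²`); for `q = 2` (then `a₁` is odd), split
iff the node-tangent quadratic `T² + T + (a₂ + a₃)` of the reduction has a root in `𝔽₂`, i.e. iff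
`a₂ + a₃` is even. [cite: SilvermanAEC2009, VII.5 Prop. 5.1(b) and C.14–C.15] -/
def splitAt (a : List ℤ) (q : ℕ) : Bool :=
  if q = 2 then
    match a with
    | [a1, a2, a3, _, _] => decide (a1 % 2 ≠ 0 ∧ (a2 + a3) % 2 = 0)
    | _ => false
  else isQR (-(c6Of a)) q

/-- The Tamagawa number of reduction type `I_n` (`n ≥ 1`): `n` if split, else `2` for even `n` and `1`
for odd `n` (Tate's algorithm). [cite: SilvermanAEC2009, C.15 (Table 15.1, type I_n)] -/
def tateTamagawa (split : Bool) (n : ℕ) : ℕ := if split then n else if n % 2 = 0 then 2 else 1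

/-! ### The record -/

/-- One certificate record of the leaf X6 ∧ `r_an = 0`: the DATA of one (Cremona class, prime) pair,
see the module docstring for the meaning of each field. A record asserts nothing by itself;
`Record.check` is its decidable recheck. [folklore] -/
structure Record where
  /-- Cremona label of the curve (curve number 1 of its isogeny class, e.g. `"2534e1"`). -/
  label : String
  /-- a-invariants `[a₁, a₂, a₃, a₄, a₆]` of the reduced global minimal model. -/
  ainvs : List ℤ
  /-- the conductor `N` (square-free). -/
  conductor : ℕ
  /-- the prime `p` (odd, of good supersingular reduction; `p = 3` only with `a₃ = 0`). -/
  p : ℕ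
  /-- `(q, v_q(Δ_min))` for every bad prime `q`, increasing in `q` (all of type `I_{v_q(Δ)}`). -/
  bad : List (ℕ × ℕ)
  /-- `#Ẽ(𝔽_p)` (projective points of the reduction at `p`); `= p + 1`, i.e. `a_p = 0`. -/
  pointCount : ℕ
  /-- degrees of the rational isogenies from the curve (Cremona `allisog` row, `1` included; documentation). -/
  isogDegrees : List ℕ
  /-- Sutherland image labels at the non-surjective primes (Cremona `galrep`; documentation). -/
  galrep : List String
  /-- `#E(ℚ)_tors`. -/
  torsion : ℕ
  /-- `(q, c_q)` for every bad prime `q`, increasing in `q`. -/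
  tamagawa : List (ℕ × ℕ)
  /-- the Tamagawa product `∏_q c_q`. -/
  tamagawaProduct : ℕ
  /-- the Mordell–Weil rank (Cremona) = the analytic rank (engines), here `0`. -/
  rank : ℕ
  /-- the global root number, here `+1`. -/
  rootNumber : ℤ
  /-- numerator of `L(E,1)/Ω_E` (exact, lowest terms; `Ω_E` = Cremona's `Ω`). -/
  lRatioNum : ℕ
  /-- denominator of `L(E,1)/Ω_E`. -/
  lRatioDen : ℕ
  /-- the analytic order of `Ш`, `#Ш_an = L(E,1)/Ω_E · #E(ℚ)_tors² / ∏ c_q` (a positive square). -/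
  shaAn : ℕ
  /-- `v_p(#Ш_an)` (`> 0` on the sweep residue). -/
  ordpSha : ℕ
  /-- `v_p(∏ c_q)`. -/
  ordpTam : ℕ
  /-- the (ram) primes: bad `q ≠ p` with `p ∤ v_q(Δ_min)`. -/
  ram : List ℕ
  /-- `D` of the auxiliary field `L = ℚ(√−D)` of BSTW §10.3 (`0` = none recorded). -/
  auxDisc : ℕ
  /-- the (ram) prime `q₀` inert in `L`. -/
  auxInert : ℕ
  /-- the form class number `h(−D)` (`= h_L`). -/
  auxClassNumber : ℕ
  /-- road-specific CLAIMED integers, `(key, value)` (e.g. `("dimSel3", 2)`); not rechecked. -/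
  ext : List (String × ℤ)
  /-- provenance strings (engines, kit job ids); documentation only. -/
  engines : List String
  deriving DecidableEq

/-! ### The recheck -/

namespace Record

variable (r : Record)

/-- The bad primes, in order. [folklore] -/
def badPrimes : List ℕ := r.bad.map (·.1)

/-- Shape, support, semistability and minimality: five a-invariants; bad primes prime, increasing;
`N = ∏ q`; `|Δ(ainvs)| = ∏ q^{v_q(Δ)}` with every `v_q(Δ) > 0` exact (`q^{v} ∣ Δ`, `q^{v+1} ∤ Δ`; RECOMPUTED
discriminant, `≠ 0`); `q ∤ c₄` at every bad `q` and `gcd(Δ, c₄) = 1` (multiplicative reduction everywhere bad;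
Silverman's minimality criterion).
[cite: SilvermanAEC2009, VII.5 Prop. 5.1(b) and VII.1 Remark 1.1] -/
def checkSupport : Bool :=
  (r.ainvs.length == 5) &&
  r.bad.all (fun t => isPrimeBelow504100 t.1 && decide (0 < t.2) && decide (c4Of r.ainvs % (t.1 : ℤ) ≠ 0) &&
    decide ((discOf r.ainvs).natAbs % t.1 ^ t.2 = 0) && decide ((discOf r.ainvs).natAbs % t.1 ^ (t.2 + 1) ≠ 0)) &&
  strictlyIncreasing r.badPrimes &&
  (r.badPrimes.prod == r.conductor) &&
  ((r.bad.map fun t => t.1 ^ t.2).prod == (discOf r.ainvs).natAbs) &&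
  decide (discOf r.ainvs ≠ 0) && (Int.gcd (discOf r.ainvs) (c4Of r.ainvs) == 1)

/-- Good supersingular reduction at the odd prime `p` with `a_p = 0`, read off the minimal model:
`p` prime, odd, `p = 3 ∨ 5 ≤ p`, `p ∤ Δ`, `#Ẽ(𝔽_p) = countPoints = p + 1`.
[cite: SilvermanAEC2009, VII.5 Prop. 5.1(a)] -/
def checkReduction : Bool :=
  isPrimeBelow504100 r.p && decide (r.p % 2 = 1) && decide (r.p = 3 ∨ 5 ≤ r.p) &&
  decide (discOf r.ainvs % (r.p : ℤ) ≠ 0) &&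
  (countPoints r.ainvs r.p == (r.pointCount : ℤ)) && (r.pointCount == r.p + 1)

/-- Tamagawa numbers: one entry per bad prime, in order, each `c_q = tateTamagawa (splitAt ainvs q) v_q(Δ)`,
and `tamagawaProduct = ∏ c_q > 0`. [cite: SilvermanAEC2009, C.15 (Table 15.1, type I_n)] -/
def checkTamagawa : Bool :=
  (r.tamagawa.map (·.1) == r.badPrimes) &&
  r.bad.all (fun t => (r.tamagawa.find? fun s => s.1 == t.1).map (·.2) == some (tateTamagawa (splitAt r.ainvs t.1) t.2)) &&
  ((r.tamagawa.map (·.2)).prod == r.tamagawaProduct) && decide (0 < r.tamagawaProduct)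

/-- Invariants and the rank-`0` bookkeeping: `rank = 0`, `rootNumber = +1`, `0 < torsion`, `p ∤ torsion`,
`0 < lRatioNum`, `0 < lRatioDen`, `gcd(lRatioNum, lRatioDen) = 1`, `#Ш_an · ∏ c_q · lRatioDen = lRatioNum · #tor²`,
`#Ш_an` a positive square, `ordpSha = v_p(#Ш_an)`, `ordpTam = v_p(∏ c_q)`. [cite: Miller2011LMS, Def. 1.1] -/
def checkBookkeeping : Bool :=
  (r.rank == 0) && (r.rootNumber == 1) && decide (0 < r.torsion) && decide (r.torsion % r.p ≠ 0) &&
  decide (0 < r.lRatioNum) && decide (0 < r.lRatioDen) && (Nat.gcd r.lRatioNum r.lRatioDen == 1) &&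
  (r.shaAn * r.tamagawaProduct * r.lRatioDen == r.lRatioNum * r.torsion ^ 2) &&
  decide (0 < r.shaAn) && isSquareNat r.shaAn &&
  (r.ordpSha == natVal r.p r.shaAn) && (r.ordpTam == natVal r.p r.tamagawaProduct)

/-- (ram) primes: each `q ∈ ram` is a listed bad prime `(q, v_q(Δ))` with `q ≠ p` and `p ∤ v_q(Δ)`.
[cite: SkinnerUrban2014, Thm. 2 (ram)] -/
def checkRam : Bool :=
  r.ram.all (fun q => r.bad.any (fun t => (t.1 == q) && decide (q ≠ r.p) && decide (t.2 % r.p ≠ 0)))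

/-- The auxiliary datum of BSTW §10.3 (vacuous when `auxDisc = 0`): `D ≡ 3 (mod 4)`, `D < 504100`,
square-free, prime to `N`; `q₀ ∈ ram`; `(−D | p) = +1`; `(−D | q₀) = −1` (`D ≡ 3 (mod 8)` if `q₀ = 2`);
`(−D | q) = +1` at every other bad `q` (`D ≡ 7 (mod 8)` if `q = 2`); `D ≡ 7 (mod 8)` when `2 ∤ N`;
`auxClassNumber = h(−D)` (the tree's `Quadratic.BinQF.classNumber`) and `p ∤ h(−D)`.
[cite: Cox2013, Thm. 2.13] -/
def checkWitness : Bool :=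
  (r.auxDisc == 0) ||
  (decide (r.auxDisc % 4 = 3) && decide (r.auxDisc < 504100) &&
    (List.range 710).all (fun d => decide (d < 2 ∨ r.auxDisc % (d * d) ≠ 0)) &&
    (Nat.gcd r.auxDisc r.conductor == 1) &&
    r.ram.contains r.auxInert &&
    isQR (-(r.auxDisc : ℤ)) r.p &&
    r.badPrimes.all (fun q =>
      if q = r.auxInert then (if q = 2 then decide (r.auxDisc % 8 = 3) else isQNR (-(r.auxDisc : ℤ)) q)
      else (if q = 2 then decide (r.auxDisc % 8 = 7) else isQR (-(r.auxDisc : ℤ)) q)) &&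
    (r.badPrimes.contains 2 || decide (r.auxDisc % 8 = 7)) &&
    (r.auxClassNumber == BinQF.classNumber (-(r.auxDisc : ℤ))) && decide (r.auxClassNumber % r.p ≠ 0))

/-- The full recheck of a record (conjunction of the six checks above). [folklore] -/
def check : Bool :=
  r.checkSupport && r.checkReduction && r.checkTamagawa && r.checkBookkeeping && r.checkRam && r.checkWitness

end Record

/-- A list of records is certified when every one passes `Record.check` (a `Bool`; each generated file
`RankZeroCertificateRecords*.lean` states `certified [r₁, …] = true` and proves it by `decide +kernel`,
i.e. the kernel re-runs every recheck on the literal data). [folklore] -/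
def certified (rs : List Record) : Bool := rs.all Record.check

/-- Unpacking `certified`: every listed record passes the recheck. [folklore] -/
theorem check_of_mem_of_certified {rs : List Record} (h : certified rs = true) {r : Record} (hr : r ∈ rs) :
    r.check = true :=
  List.all_eq_true.1 h r hr

/-- `certified` lists concatenate. [folklore] -/
theorem certified_append {rs rs' : List Record} (h : certified rs = true) (h' : certified rs' = true) :
    certified (rs ++ rs') = true := by
  unfold certified at *
  rw [List.all_append, h, h', Bool.and_self]

namespace Record

variable (r : Record)

/-- Projections of a passing recheck: all six component checks hold. [folklore] -/
theorem checks_of_check (h : r.check = true) :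
    r.checkSupport = true ∧ r.checkReduction = true ∧ r.checkTamagawa = true ∧ r.checkBookkeeping = true ∧
      r.checkRam = true ∧ r.checkWitness = true := by
  simp only [check, Bool.and_eq_true] at h
  obtain ⟨⟨⟨⟨⟨h1, h2⟩, h3⟩, h4⟩, h5⟩, h6⟩ := h
  exact ⟨h1, h2, h3, h4, h5, h6⟩

/-- A passing record has `p = 3 ∨ 5 ≤ p`, `p` odd, `p ∤ Δ(ainvs)` and `#Ẽ(𝔽_p) = p + 1`. [folklore] -/
theorem reduction_of_check (h : r.check = true) :
    (r.p = 3 ∨ 5 ≤ r.p) ∧ r.p % 2 = 1 ∧ ¬ (r.p : ℤ) ∣ discOf r.ainvs ∧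
      countPoints r.ainvs r.p = (r.p : ℤ) + 1 := by
  have h' := (r.checks_of_check h).2.1
  simp only [checkReduction, Bool.and_eq_true, decide_eq_true_eq, beq_iff_eq] at h'
  obtain ⟨⟨⟨⟨⟨-, hodd⟩, h35⟩, hΔ⟩, hc⟩, hn⟩ := h'
  refine ⟨h35, hodd, fun hd => hΔ (Int.emod_eq_zero_of_dvd hd), ?_⟩
  rw [hc, hn]; push_cast; ring

/-- A passing record has five a-invariants, `Δ(ainvs) ≠ 0` and `gcd(Δ, c₄) = 1`. [folklore] -/
theorem support_of_check (h : r.check = true) :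
    r.ainvs.length = 5 ∧ discOf r.ainvs ≠ 0 ∧ Int.gcd (discOf r.ainvs) (c4Of r.ainvs) = 1 := by
  have h' := (r.checks_of_check h).1
  simp only [checkSupport, Bool.and_eq_true, decide_eq_true_eq, beq_iff_eq] at h'
  obtain ⟨⟨⟨⟨⟨⟨hlen, -⟩, -⟩, -⟩, -⟩, hne⟩, hg⟩ := h'
  exact ⟨hlen, hne, hg⟩

/-- A passing record has `3 ≤ p` and `p ≠ 2`. [folklore] -/
theorem three_le_of_check (h : r.check = true) : 3 ≤ r.p ∧ r.p ≠ 2 := by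
  obtain ⟨h35, hodd, -⟩ := r.reduction_of_check h
  omega

/-- A passing record's bookkeeping: `rank = 0`, `0 < #tor`, `p ∤ #tor`, `0 < lRatioNum`, `0 < lRatioDen`,
`#Ш_an · ∏c · lRatioDen = lRatioNum · #tor²`, `0 < #Ш_an`, `0 < ∏c`, `ordpSha = v_p(#Ш_an)`. [folklore] -/
theorem invariants_of_check (h : r.check = true) :
    r.rank = 0 ∧ 0 < r.torsion ∧ ¬ r.p ∣ r.torsion ∧ 0 < r.lRatioNum ∧ 0 < r.lRatioDen ∧
      r.shaAn * r.tamagawaProduct * r.lRatioDen = r.lRatioNum * r.torsion ^ 2 ∧ 0 < r.shaAn ∧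
      0 < r.tamagawaProduct ∧ r.ordpSha = natVal r.p r.shaAn := by
  have h' := (r.checks_of_check h).2.2.2.1
  have ht := (r.checks_of_check h).2.2.1
  simp only [checkBookkeeping, Bool.and_eq_true, decide_eq_true_eq, beq_iff_eq] at h'
  simp only [checkTamagawa, Bool.and_eq_true, decide_eq_true_eq] at ht
  obtain ⟨⟨⟨⟨⟨⟨⟨⟨⟨⟨⟨hr, -⟩, ht0⟩, htp⟩, hn⟩, hd⟩, -⟩, hbk⟩, hs⟩, -⟩, ho⟩, -⟩ := h'
  exact ⟨hr, ht0, fun hdvd => htp (Nat.mod_eq_zero_of_dvd hdvd), hn, hd, hbk, hs, ht.2, ho⟩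

end Record

set_option maxRecDepth 100000 -- literal `List.range 710` / `List.range p` unfold past the default depth

/-- SAMPLE (and regression test of the recheck): the record of `2534e1 @ 3` — the first pair of the sweep
residue (`N = 2·7·181`, `Δ = −2⁴⁴·7·181²`, `#Ẽ(𝔽₃) = 4`, `c₂ = 44` (split, `I₄₄`), `c₇ = 1` (non-split, `I₁`),
`c₁₈₁ = 2` (non-split, `I₂`), `#E(ℚ)_tors = 4`, `L(E,1)/Ω_E = 99/2`, `#Ш_an = 9`; auxiliary datum `q₀ = 181`,
`L = ℚ(√−47)`, `h(−47) = 5`) passes. [folklore] -/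
theorem certified_sample : certified [
  { label := "2534e1", ainvs := [1, -1, 1, -1393324, -640018129], conductor := 2534, p := 3,
    bad := [(2, 44), (7, 1), (181, 2)], pointCount := 4, isogDegrees := [1, 2, 4, 4],
    galrep := ["2B"], torsion := 4, tamagawa := [(2, 44), (7, 1), (181, 2)], tamagawaProduct := 88,
    rank := 0, rootNumber := 1, lRatioNum := 99, lRatioDen := 2, shaAn := 9, ordpSha := 2, ordpTam := 0,
    ram := [2, 7, 181], auxDisc := 47, auxInert := 181, auxClassNumber := 5, ext := [],
    engines := ["T:Cremona ecdata allcurves/allbsd/allisog/galrep", "P:PARI 2.17.2 cypari2 kit j278758 +msfromell"] } ] = true := by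
  decide +kernel

/-- Tampering is caught: the same record with `shaAn := 1` (and the bookkeeping adjusted, `lRatioNum := 11`)
fails — the kernel finds `ordpSha = 2 ≠ v₃(1)`; and with `pointCount := 5` it would find `countPoints = 4`. [folklore] -/
theorem not_certified_tampered : certified [
  { label := "2534e1", ainvs := [1, -1, 1, -1393324, -640018129], conductor := 2534, p := 3,
    bad := [(2, 44), (7, 1), (181, 2)], pointCount := 4, isogDegrees := [1, 2, 4, 4],
    galrep := ["2B"], torsion := 4, tamagawa := [(2, 44), (7, 1), (181, 2)], tamagawaProduct := 88,
    rank := 0, rootNumber := 1, lRatioNum := 11, lRatioDen := 2, shaAn := 1, ordpSha := 2, ordpTam := 0,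
    ram := [2, 7, 181], auxDisc := 47, auxInert := 181, auxClassNumber := 5, ext := [],
    engines := [] } ] = false := by
  decide +kernel

end Summit.BirchSwinnertonDyer.Rank1Residual.X6.PrintCert
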